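import Mathlib
import HarnessLib
import Summits.AtomisticToContinuum.FouriersLaw.Theses.JunctionLocality
import Summits.AtomisticToContinuum.FouriersLaw.Theorems.JunctionLocalitySuperadditiveResistanceStubProbeRemovalCostAux3

/-!
# Probe-removal cost in the κ-frame, helper IV: the JUNCTION PAIRING and the LOSSLESS reduction of S3' to two explicit
# `N`-uniform junction-pairing inequalities
(helper `--supports` stmt-AtomisticToContinuum-11748 for stub `stub_probeRemovalCost` (S3') of line
`floating-probe-bypass-laplacian`, skeleton v7/v8, crux `JunctionLocality.SuperadditiveResistance`)

With the JUNCTION PAIRING `Π(h, g) = κ⟨h∘R, g⟩ + γT Σ_{s∈{N−1,N}} ⟨∂_{p_s}(h∘R), ∂_{p_s} g⟩` (pairings in `L²(μ_T^{(N+M)})`, `R` the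
momentum reversal; written out in full in every statement — no definition is introduced), `S` the site reflection,
`G_L = plainKubo … gL`, `c = γ²/T²`, and the abbreviations `Π_L0 = Π(gL, g 0)`, `Π_R3 = Π(gL∘S, g 3)`, `Π_R0 = Π(gL∘S, g 0)`:

* `schurVariables_eq_junctionPairing` — helper III's four identities for a resolvent family and a plain forward field with
  square-integrable momentum gradients: `a − G_L = cΠ_L0`, `b − G_L = cΠ_R3`, `G_L + K₀₃ = cΠ_R0 = G_L + K₃₀ = cΠ(gL, g 3)`;
  hence `a + b − 2x = c(Π_L0 + Π_R3 + 2Π_R0)` and `ab − x² = G_L c(Π_L0 + Π_R3 + 2Π_R0) + c²(Π_L0 Π_R3 − Π_R0²)`;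
* `probeRemoval_algebra` — the two clauses of S3' ⇔
  (J1) `c(Π_R0² − Π_L0 Π_R3)(1 + C₂G_L) ≤ C₂ G_L²(Π_L0 + Π_R3 + 2Π_R0)` (second-order cancellation: in a resistor caricature
  `Π_R0² = Π_L0 Π_R3` exactly) and (J2) `G_L ≤ C₂ c(Π_L0 + Π_R3 + 2Π_R0)` (connectivity margin), pure real algebra;
* `stub_probeRemovalCost_of_junctionPairingBounds` — **the registered stub follows from** (R) square-integrability of all
  momentum gradients of plain forward fields of every length (interior sites: NOT proved in the tree) **and** (J) =
  `∃ C₂ > 0`, (J1) ∧ (J2) for all splits, eventually in `κ`, all resolvent families and plain fields — same `C₂`, same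
  thresholds; `junctionPairingBounds_of_stub_probeRemovalCost` is the converse (under (R)), so the reduction is LOSSLESS;
  `connectivityMargin_iff_junctionPairing` (registered as `helper_probeRemovalConnectivityReduction`) is the pointwise
  form of the connectivity clause.

What is NOT here: (R) at interior sites, and any `N`-uniform bound — (J1)/(J2) are the isolated `N`-uniform content of S3'
(no estimate uniform in the length is known for this chain, cf. Bonetto–Lebowitz–Rey-Bellet 2000 §6.3). Standard axioms; no
definitions; nothing taken as a named fact.
-/
noncomputable section

open MeasureTheory Filter Topology
open scoped ContDiff
open Literature.MathematicalPhysics.KineticTheory.HeatConduction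
open Summit.AtomisticToContinuum.FouriersLaw.Theorems.SuperadditiveResistance.DeviceLiouville
  (kin deviceGenerator deviceWeight deviceGenerator_eq kin_eq_sq liouvilleOp bathOp generator_eq_liouvilleOp_add)
open Summit.AtomisticToContinuum.FouriersLaw.Theorems.SuperadditiveResistance.Kubo
  (rev rev_apply contDiff_rev continuous_rev memLp_rev rev_pair partialP_rev_eq cross_level chi contDiff_chi
    hasCompactSupport_chi memLp_partialP integrable_mul_mul_gibbsDensity integral_rev_mul_gibbsDensity
    tendsto_integral_chi_mul tendsto_integral_partialP_chi_mul integral_chi_mul_bathOp continuous_source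
    continuous_bathOp tendsto_sum_mul)
open Summit.AtomisticToContinuum.FouriersLaw.Cruxes.ConductanceLowerBound.ForecastSensitivity
  (measurePreserving_siteReflection_gibbsMeasure kin_zero_siteReflection)
open Summit.AtomisticToContinuum.FouriersLaw.Cruxes.SuperadditiveResistance.ThermaliseThenCutProbeInsertion
  (plainField_endPairing)

namespace Summit.AtomisticToContinuum.FouriersLaw.Cruxes.SuperadditiveResistance.FloatingProbeBypassLaplacian

/-! ## The four identities in junction-pairing form -/

section Reduction

variable {ω₂ lam β γ T : ℝ} {N M : ℕ}

/-- **The four identities in pairing form, for a resolvent family and a plain forward field with square-integrable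
momentum gradients (`N, M ≥ 2`, `κ ≥ 0`; all parameters `> 0`).** With `gR = gL ∘ siteReflection`, `c = γ²/T²` and
`Π(h, g_a) = κ⟨h∘R, g_a⟩ + γT(⟨∂_{p_{N−1}}(h∘R), ∂_{p_{N−1}} g_a⟩ + ⟨∂_{p_N}(h∘R), ∂_{p_N} g_a⟩)` written out:
`K₀₀ − G_L = cΠ(gL, g 0)`, `K₃₃ − G_L = cΠ(gR, g 3)`, `G_L + K₀₃ = cΠ(gR, g 0)`, `G_L + K₃₀ = cΠ(gL, g 3)`, and the
consistency `Π(gR, g 0) = Π(gL, g 3)` (Onsager symmetry `K₀₃ = K₃₀` of the resolvent frame). -/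
theorem schurVariables_eq_junctionPairing (hω : 0 < ω₂) (hl : 0 < lam) (hβ : 0 < β) (hγ : 0 < γ) (hT : 0 < T)
    (hN : 2 ≤ N) (hM : 2 ≤ M) {κ : ℝ} (hκ : 0 ≤ κ) (g : Fin 4 → PhaseSpace (N + M) → ℝ) (gL : PhaseSpace (N + M) → ℝ)
    (hg : ∀ a : Fin 4, g a ∈ deviceResolventFields ω₂ lam β γ T N M (termSite N M a) κ)
    (hgL : gL ∈ plainForwardFields ω₂ lam β γ T (N + M))
    (hreg : ∀ i : Fin (N + M), MemLp (partialP i gL) 2 ((pinnedChain ω₂ lam β γ).gibbsMeasure (N + M) T)) :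
    kuboMatrix ω₂ lam β γ T N M g 0 0 - plainKubo ω₂ lam β γ T (N + M) gL = γ ^ 2 / T ^ 2 *
        (κ * ∫ x, gL (x.1, -x.2) * g 0 x ∂((pinnedChain ω₂ lam β γ).gibbsMeasure (N + M) T) +
          γ * T * ((∫ x, partialP ⟨N - 1, by omega⟩ (fun y : PhaseSpace (N + M) => gL (y.1, -y.2)) x *
              partialP ⟨N - 1, by omega⟩ (g 0) x ∂((pinnedChain ω₂ lam β γ).gibbsMeasure (N + M) T)) +
            ∫ x, partialP ⟨N, by omega⟩ (fun y : PhaseSpace (N + M) => gL (y.1, -y.2)) x *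
              partialP ⟨N, by omega⟩ (g 0) x ∂((pinnedChain ω₂ lam β γ).gibbsMeasure (N + M) T))) ∧
      kuboMatrix ω₂ lam β γ T N M g 3 3 - plainKubo ω₂ lam β γ T (N + M) gL = γ ^ 2 / T ^ 2 *
        (κ * ∫ x, (gL ∘ siteReflection (N + M)) (x.1, -x.2) * g 3 x ∂((pinnedChain ω₂ lam β γ).gibbsMeasure (N + M) T) +
          γ * T * ((∫ x, partialP ⟨N - 1, by omega⟩ (fun y : PhaseSpace (N + M) => (gL ∘ siteReflection (N + M)) (y.1, -y.2)) x *
              partialP ⟨N - 1, by omega⟩ (g 3) x ∂((pinnedChain ω₂ lam β γ).gibbsMeasure (N + M) T)) +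
            ∫ x, partialP ⟨N, by omega⟩ (fun y : PhaseSpace (N + M) => (gL ∘ siteReflection (N + M)) (y.1, -y.2)) x *
              partialP ⟨N, by omega⟩ (g 3) x ∂((pinnedChain ω₂ lam β γ).gibbsMeasure (N + M) T))) ∧
      plainKubo ω₂ lam β γ T (N + M) gL + kuboMatrix ω₂ lam β γ T N M g 0 3 = γ ^ 2 / T ^ 2 *
        (κ * ∫ x, (gL ∘ siteReflection (N + M)) (x.1, -x.2) * g 0 x ∂((pinnedChain ω₂ lam β γ).gibbsMeasure (N + M) T) +
          γ * T * ((∫ x, partialP ⟨N - 1, by omega⟩ (fun y : PhaseSpace (N + M) => (gL ∘ siteReflection (N + M)) (y.1, -y.2)) x *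
              partialP ⟨N - 1, by omega⟩ (g 0) x ∂((pinnedChain ω₂ lam β γ).gibbsMeasure (N + M) T)) +
            ∫ x, partialP ⟨N, by omega⟩ (fun y : PhaseSpace (N + M) => (gL ∘ siteReflection (N + M)) (y.1, -y.2)) x *
              partialP ⟨N, by omega⟩ (g 0) x ∂((pinnedChain ω₂ lam β γ).gibbsMeasure (N + M) T))) ∧
      plainKubo ω₂ lam β γ T (N + M) gL + kuboMatrix ω₂ lam β γ T N M g 3 0 = γ ^ 2 / T ^ 2 *
        (κ * ∫ x, gL (x.1, -x.2) * g 3 x ∂((pinnedChain ω₂ lam β γ).gibbsMeasure (N + M) T) +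
          γ * T * ((∫ x, partialP ⟨N - 1, by omega⟩ (fun y : PhaseSpace (N + M) => gL (y.1, -y.2)) x *
              partialP ⟨N - 1, by omega⟩ (g 3) x ∂((pinnedChain ω₂ lam β γ).gibbsMeasure (N + M) T)) +
            ∫ x, partialP ⟨N, by omega⟩ (fun y : PhaseSpace (N + M) => gL (y.1, -y.2)) x *
              partialP ⟨N, by omega⟩ (g 3) x ∂((pinnedChain ω₂ lam β γ).gibbsMeasure (N + M) T))) ∧
      (κ * ∫ x, (gL ∘ siteReflection (N + M)) (x.1, -x.2) * g 0 x ∂((pinnedChain ω₂ lam β γ).gibbsMeasure (N + M) T) +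
        γ * T * ((∫ x, partialP ⟨N - 1, by omega⟩ (fun y : PhaseSpace (N + M) => (gL ∘ siteReflection (N + M)) (y.1, -y.2)) x *
            partialP ⟨N - 1, by omega⟩ (g 0) x ∂((pinnedChain ω₂ lam β γ).gibbsMeasure (N + M) T)) +
          ∫ x, partialP ⟨N, by omega⟩ (fun y : PhaseSpace (N + M) => (gL ∘ siteReflection (N + M)) (y.1, -y.2)) x *
            partialP ⟨N, by omega⟩ (g 0) x ∂((pinnedChain ω₂ lam β γ).gibbsMeasure (N + M) T))) =
        (κ * ∫ x, gL (x.1, -x.2) * g 3 x ∂((pinnedChain ω₂ lam β γ).gibbsMeasure (N + M) T) +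
          γ * T * ((∫ x, partialP ⟨N - 1, by omega⟩ (fun y : PhaseSpace (N + M) => gL (y.1, -y.2)) x *
              partialP ⟨N - 1, by omega⟩ (g 3) x ∂((pinnedChain ω₂ lam β γ).gibbsMeasure (N + M) T)) +
            ∫ x, partialP ⟨N, by omega⟩ (fun y : PhaseSpace (N + M) => gL (y.1, -y.2)) x *
              partialP ⟨N, by omega⟩ (g 3) x ∂((pinnedChain ω₂ lam β γ).gibbsMeasure (N + M) T))) := by
  have hN1 : 1 ≤ N := by omega
  have hM1 : 1 ≤ M := by omega
  have h1 := kuboMatrix_zero_zero_sub_plainKubo_dirichlet hω hl.le hβ.le hγ hT hM1 κ g gL (hg 0) hgL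
    (hreg ⟨N - 1, by omega⟩) (hreg ⟨N, by omega⟩)
  have h2 := kuboMatrix_three_three_sub_plainKubo_dirichlet hω hl.le hβ.le hγ hT hN1 hM1 κ g gL (hg 3) hgL
    (hreg ⟨M - 1, by omega⟩) (hreg ⟨M, by omega⟩)
  have h3 := plainKubo_add_kuboMatrix_zero_three_dirichlet hω hl.le hβ hγ hT hN1 hM1 κ g gL (hg 0) hgL
    (hreg ⟨M - 1, by omega⟩) (hreg ⟨M, by omega⟩)
  have h4 := plainKubo_add_kuboMatrix_three_zero_dirichlet hω hl.le hβ hγ hT hN1 hM1 κ g gL (hg 3) hgL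
    (hreg ⟨N - 1, by omega⟩) (hreg ⟨N, by omega⟩)
  have hsymm : kuboMatrix ω₂ lam β γ T N M g 0 3 = kuboMatrix ω₂ lam β γ T N M g 3 0 :=
    kuboMatrix_symm_resolvent hω hl.le hβ.le hγ hT hN hM hκ g hg 0 3
  refine ⟨h1, h2, h3, h4, ?_⟩
  have hc : 0 < γ ^ 2 / T ^ 2 := by positivity
  have h3' := h3
  rw [hsymm] at h3'
  exact mul_left_cancel₀ hc.ne' (h3'.symm.trans h4)

/-- **The exact algebra of S3' in pairing variables.** If `a − G = cΠ_L0`, `b − G = cΠ_R3`, `G + k = cΠ_R0` with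
`c > 0` (`k = K₀₃`, so `a + b + 2k = c(Π_L0 + Π_R3 + 2Π_R0)` and
`ab − k² = Gc(Π_L0 + Π_R3 + 2Π_R0) + c²(Π_L0 Π_R3 − Π_R0²)`), then the two clauses of S3' are EQUIVALENT to the
second-order cancellation bound `c(Π_R0² − Π_L0 Π_R3)(1 + C G) ≤ C G²(Π_L0 + Π_R3 + 2Π_R0)` together with the
connectivity margin `G ≤ C c (Π_L0 + Π_R3 + 2Π_R0)`. -/
theorem probeRemoval_algebra {a b k G c PL0 PR3 PR0 C : ℝ} (hc : 0 < c) (ha : a - G = c * PL0)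
    (hb : b - G = c * PR3) (hk : G + k = c * PR0) :
    (G * (a + b + 2 * k) ≤ (a * b - k ^ 2) * (1 + C * G) ∧ G ≤ C * (a + b + 2 * k)) ↔
      (c * (PR0 ^ 2 - PL0 * PR3) * (1 + C * G) ≤ C * G ^ 2 * (PL0 + PR3 + 2 * PR0) ∧
        G ≤ C * c * (PL0 + PR3 + 2 * PR0)) := by
  have ha' : a = G + c * PL0 := by linarith
  have hb' : b = G + c * PR3 := by linarith
  have hk' : k = c * PR0 - G := by linarith
  subst ha' hb' hk'
  have key : ((G + c * PL0) * (G + c * PR3) - (c * PR0 - G) ^ 2) * (1 + C * G) -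
      G * ((G + c * PL0) + (G + c * PR3) + 2 * (c * PR0 - G)) =
      c * (C * G ^ 2 * (PL0 + PR3 + 2 * PR0) - c * (PR0 ^ 2 - PL0 * PR3) * (1 + C * G)) := by ring
  have hsum : (G + c * PL0) + (G + c * PR3) + 2 * (c * PR0 - G) = c * (PL0 + PR3 + 2 * PR0) := by ring
  constructor
  · rintro ⟨h1, h2⟩
    refine ⟨?_, ?_⟩
    · have h0 : 0 ≤ c * (C * G ^ 2 * (PL0 + PR3 + 2 * PR0) - c * (PR0 ^ 2 - PL0 * PR3) * (1 + C * G)) := by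
        rw [← key]; linarith
      have := (mul_nonneg_iff_of_pos_left hc).mp h0
      linarith
    · rw [hsum] at h2; linarith
  · rintro ⟨h1, h2⟩
    refine ⟨?_, ?_⟩
    · have h0 : 0 ≤ c * (C * G ^ 2 * (PL0 + PR3 + 2 * PR0) - c * (PR0 ^ 2 - PL0 * PR3) * (1 + C * G)) :=
        mul_nonneg hc.le (by linarith)
      rw [← key] at h0; linarith
    · rw [hsum]; linarith

/-! ## The lossless reduction of the registered stub -/

/-- **THE REGISTERED STUB FROM THE TWO JUNCTION-PAIRING INEQUALITIES (lossless reduction of S3').** Assume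
(R) every plain forward field of every length has square-integrable momentum gradients at every site (at the two bathed
sites this is the landed `Kubo.memLp_partialP`; at INTERIOR sites it is the junction-gradient regularity this line has not
proved), and (J) for some `C₂ > 0`, all splits `N, M ≥ 2`, eventually in `κ → 0⁺`, all resolvent families `g` and plain forward
fields `gL` of the whole chain, with `Π_L0 = Π(gL, g 0)`, `Π_R3 = Π(gL∘S, g 3)`, `Π_R0 = Π(gL∘S, g 0)` (written out; `S` the
site reflection) and `G_L = plainKubo … gL`:
  (J1) `(γ²/T²)(Π_R0² − Π_L0 Π_R3)(1 + C₂ G_L) ≤ C₂ G_L² (Π_L0 + Π_R3 + 2Π_R0)`  — second-order cancellation,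
  (J2) `G_L ≤ C₂ (γ²/T²)(Π_L0 + Π_R3 + 2Π_R0)`                              — connectivity margin.
Then `stub_probeRemovalCost` holds at these parameters with the SAME `C₂` and thresholds (the four κ-frame identities
make (J1) ∧ (J2) and the stub's two clauses the same pair of real inequalities, `probeRemoval_algebra`). Nothing
`N`-uniform is claimed here; (J1)/(J2) are exactly the `N`-uniform content of S3'. -/
theorem stub_probeRemovalCost_of_junctionPairingBounds :
    ∀ ω₂ lam β γ T : ℝ, 0 < ω₂ → 0 < lam → 0 < β → 0 < γ → 0 < T →
      (∀ (L : ℕ) (gL : PhaseSpace L → ℝ), gL ∈ plainForwardFields ω₂ lam β γ T L →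
        ∀ i : Fin L, MemLp (partialP i gL) 2 ((pinnedChain ω₂ lam β γ).gibbsMeasure L T)) →
      (∃ C₂ : ℝ, 0 < C₂ ∧ ∀ (N M : ℕ) (hN : 2 ≤ N) (hM : 2 ≤ M), ∃ κ₂ : ℝ, 0 < κ₂ ∧ ∀ κ : ℝ, 0 < κ → κ ≤ κ₂ →
        ∀ (g : Fin 4 → PhaseSpace (N + M) → ℝ) (gL : PhaseSpace (N + M) → ℝ),
          (∀ a : Fin 4, g a ∈ deviceResolventFields ω₂ lam β γ T N M (termSite N M a) κ) →
          gL ∈ plainForwardFields ω₂ lam β γ T (N + M) →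
          γ ^ 2 / T ^ 2 *
                ((κ * ∫ x, (gL ∘ siteReflection (N + M)) (x.1, -x.2) * g 0 x ∂((pinnedChain ω₂ lam β γ).gibbsMeasure (N + M) T) +
                  γ * T * ((∫ x, partialP ⟨N - 1, by omega⟩ (fun y : PhaseSpace (N + M) => (gL ∘ siteReflection (N + M)) (y.1, -y.2)) x *
                      partialP ⟨N - 1, by omega⟩ (g 0) x ∂((pinnedChain ω₂ lam β γ).gibbsMeasure (N + M) T)) +
                    ∫ x, partialP ⟨N, by omega⟩ (fun y : PhaseSpace (N + M) => (gL ∘ siteReflection (N + M)) (y.1, -y.2)) x *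
                      partialP ⟨N, by omega⟩ (g 0) x ∂((pinnedChain ω₂ lam β γ).gibbsMeasure (N + M) T))) ^ 2 -
                (κ * ∫ x, gL (x.1, -x.2) * g 0 x ∂((pinnedChain ω₂ lam β γ).gibbsMeasure (N + M) T) +
                  γ * T * ((∫ x, partialP ⟨N - 1, by omega⟩ (fun y : PhaseSpace (N + M) => gL (y.1, -y.2)) x *
                      partialP ⟨N - 1, by omega⟩ (g 0) x ∂((pinnedChain ω₂ lam β γ).gibbsMeasure (N + M) T)) +
                    ∫ x, partialP ⟨N, by omega⟩ (fun y : PhaseSpace (N + M) => gL (y.1, -y.2)) x *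
                      partialP ⟨N, by omega⟩ (g 0) x ∂((pinnedChain ω₂ lam β γ).gibbsMeasure (N + M) T))) *
                (κ * ∫ x, (gL ∘ siteReflection (N + M)) (x.1, -x.2) * g 3 x ∂((pinnedChain ω₂ lam β γ).gibbsMeasure (N + M) T) +
                  γ * T * ((∫ x, partialP ⟨N - 1, by omega⟩ (fun y : PhaseSpace (N + M) => (gL ∘ siteReflection (N + M)) (y.1, -y.2)) x *
                      partialP ⟨N - 1, by omega⟩ (g 3) x ∂((pinnedChain ω₂ lam β γ).gibbsMeasure (N + M) T)) +
                    ∫ x, partialP ⟨N, by omega⟩ (fun y : PhaseSpace (N + M) => (gL ∘ siteReflection (N + M)) (y.1, -y.2)) x *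
                      partialP ⟨N, by omega⟩ (g 3) x ∂((pinnedChain ω₂ lam β γ).gibbsMeasure (N + M) T)))) *
              (1 + C₂ * plainKubo ω₂ lam β γ T (N + M) gL) ≤
            C₂ * plainKubo ω₂ lam β γ T (N + M) gL ^ 2 *
              ((κ * ∫ x, gL (x.1, -x.2) * g 0 x ∂((pinnedChain ω₂ lam β γ).gibbsMeasure (N + M) T) +
                  γ * T * ((∫ x, partialP ⟨N - 1, by omega⟩ (fun y : PhaseSpace (N + M) => gL (y.1, -y.2)) x *
                      partialP ⟨N - 1, by omega⟩ (g 0) x ∂((pinnedChain ω₂ lam β γ).gibbsMeasure (N + M) T)) +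
                    ∫ x, partialP ⟨N, by omega⟩ (fun y : PhaseSpace (N + M) => gL (y.1, -y.2)) x *
                      partialP ⟨N, by omega⟩ (g 0) x ∂((pinnedChain ω₂ lam β γ).gibbsMeasure (N + M) T))) +
                (κ * ∫ x, (gL ∘ siteReflection (N + M)) (x.1, -x.2) * g 3 x ∂((pinnedChain ω₂ lam β γ).gibbsMeasure (N + M) T) +
                  γ * T * ((∫ x, partialP ⟨N - 1, by omega⟩ (fun y : PhaseSpace (N + M) => (gL ∘ siteReflection (N + M)) (y.1, -y.2)) x *
                      partialP ⟨N - 1, by omega⟩ (g 3) x ∂((pinnedChain ω₂ lam β γ).gibbsMeasure (N + M) T)) +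
                    ∫ x, partialP ⟨N, by omega⟩ (fun y : PhaseSpace (N + M) => (gL ∘ siteReflection (N + M)) (y.1, -y.2)) x *
                      partialP ⟨N, by omega⟩ (g 3) x ∂((pinnedChain ω₂ lam β γ).gibbsMeasure (N + M) T))) +
                2 * (κ * ∫ x, (gL ∘ siteReflection (N + M)) (x.1, -x.2) * g 0 x ∂((pinnedChain ω₂ lam β γ).gibbsMeasure (N + M) T) +
                  γ * T * ((∫ x, partialP ⟨N - 1, by omega⟩ (fun y : PhaseSpace (N + M) => (gL ∘ siteReflection (N + M)) (y.1, -y.2)) x *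
                      partialP ⟨N - 1, by omega⟩ (g 0) x ∂((pinnedChain ω₂ lam β γ).gibbsMeasure (N + M) T)) +
                    ∫ x, partialP ⟨N, by omega⟩ (fun y : PhaseSpace (N + M) => (gL ∘ siteReflection (N + M)) (y.1, -y.2)) x *
                      partialP ⟨N, by omega⟩ (g 0) x ∂((pinnedChain ω₂ lam β γ).gibbsMeasure (N + M) T)))) ∧
          plainKubo ω₂ lam β γ T (N + M) gL ≤ C₂ * (γ ^ 2 / T ^ 2) *
            ((κ * ∫ x, gL (x.1, -x.2) * g 0 x ∂((pinnedChain ω₂ lam β γ).gibbsMeasure (N + M) T) +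
                  γ * T * ((∫ x, partialP ⟨N - 1, by omega⟩ (fun y : PhaseSpace (N + M) => gL (y.1, -y.2)) x *
                      partialP ⟨N - 1, by omega⟩ (g 0) x ∂((pinnedChain ω₂ lam β γ).gibbsMeasure (N + M) T)) +
                    ∫ x, partialP ⟨N, by omega⟩ (fun y : PhaseSpace (N + M) => gL (y.1, -y.2)) x *
                      partialP ⟨N, by omega⟩ (g 0) x ∂((pinnedChain ω₂ lam β γ).gibbsMeasure (N + M) T))) +
              (κ * ∫ x, (gL ∘ siteReflection (N + M)) (x.1, -x.2) * g 3 x ∂((pinnedChain ω₂ lam β γ).gibbsMeasure (N + M) T) +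
                  γ * T * ((∫ x, partialP ⟨N - 1, by omega⟩ (fun y : PhaseSpace (N + M) => (gL ∘ siteReflection (N + M)) (y.1, -y.2)) x *
                      partialP ⟨N - 1, by omega⟩ (g 3) x ∂((pinnedChain ω₂ lam β γ).gibbsMeasure (N + M) T)) +
                    ∫ x, partialP ⟨N, by omega⟩ (fun y : PhaseSpace (N + M) => (gL ∘ siteReflection (N + M)) (y.1, -y.2)) x *
                      partialP ⟨N, by omega⟩ (g 3) x ∂((pinnedChain ω₂ lam β γ).gibbsMeasure (N + M) T))) +
              2 * (κ * ∫ x, (gL ∘ siteReflection (N + M)) (x.1, -x.2) * g 0 x ∂((pinnedChain ω₂ lam β γ).gibbsMeasure (N + M) T) +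
                  γ * T * ((∫ x, partialP ⟨N - 1, by omega⟩ (fun y : PhaseSpace (N + M) => (gL ∘ siteReflection (N + M)) (y.1, -y.2)) x *
                      partialP ⟨N - 1, by omega⟩ (g 0) x ∂((pinnedChain ω₂ lam β γ).gibbsMeasure (N + M) T)) +
                    ∫ x, partialP ⟨N, by omega⟩ (fun y : PhaseSpace (N + M) => (gL ∘ siteReflection (N + M)) (y.1, -y.2)) x *
                      partialP ⟨N, by omega⟩ (g 0) x ∂((pinnedChain ω₂ lam β γ).gibbsMeasure (N + M) T))))) →
      ∃ C₂ : ℝ, 0 < C₂ ∧ ∀ N M : ℕ, 2 ≤ N → 2 ≤ M → ∃ κ₂ : ℝ, 0 < κ₂ ∧ ∀ κ : ℝ, 0 < κ → κ ≤ κ₂ →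
        ∀ (g : Fin 4 → PhaseSpace (N + M) → ℝ) (gL : PhaseSpace (N + M) → ℝ),
          (∀ a : Fin 4, g a ∈ deviceResolventFields ω₂ lam β γ T N M (termSite N M a) κ) →
          gL ∈ plainForwardFields ω₂ lam β γ T (N + M) →
          plainKubo ω₂ lam β γ T (N + M) gL *
              (kuboMatrix ω₂ lam β γ T N M g 0 0 + kuboMatrix ω₂ lam β γ T N M g 3 3 +
                2 * kuboMatrix ω₂ lam β γ T N M g 0 3) ≤
            (kuboMatrix ω₂ lam β γ T N M g 0 0 * kuboMatrix ω₂ lam β γ T N M g 3 3 -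
                (kuboMatrix ω₂ lam β γ T N M g 0 3) ^ 2) * (1 + C₂ * plainKubo ω₂ lam β γ T (N + M) gL) ∧
          plainKubo ω₂ lam β γ T (N + M) gL ≤
            C₂ * (kuboMatrix ω₂ lam β γ T N M g 0 0 + kuboMatrix ω₂ lam β γ T N M g 3 3 +
              2 * kuboMatrix ω₂ lam β γ T N M g 0 3) := by
  intro ω₂ lam β γ T hω hl hβ hγ hT hR hJ
  obtain ⟨C₂, hC₂, hJ⟩ := hJ
  refine ⟨C₂, hC₂, fun N M hN hM => ?_⟩
  obtain ⟨κ₂, hκ₂, hJ⟩ := hJ N M hN hM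
  refine ⟨κ₂, hκ₂, fun κ hκ hκle g gL hg hgL => ?_⟩
  obtain ⟨hJ1, hJ2⟩ := hJ κ hκ hκle g gL hg hgL
  obtain ⟨h1, h2, h3, -, -⟩ :=
    schurVariables_eq_junctionPairing hω hl hβ hγ hT hN hM hκ.le g gL hg hgL (hR (N + M) gL hgL)
  have hc : 0 < γ ^ 2 / T ^ 2 := by positivity
  exact (probeRemoval_algebra hc h1 h2 h3).mpr ⟨hJ1, hJ2⟩

/-- **Losslessness: the registered stub implies the two junction-pairing inequalities** (under (R)), with the same `C₂`
and thresholds — so (J1) ∧ (J2), eventually in `κ`, IS S3'. -/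
theorem junctionPairingBounds_of_stub_probeRemovalCost :
    ∀ ω₂ lam β γ T : ℝ, 0 < ω₂ → 0 < lam → 0 < β → 0 < γ → 0 < T →
      (∀ (L : ℕ) (gL : PhaseSpace L → ℝ), gL ∈ plainForwardFields ω₂ lam β γ T L →
        ∀ i : Fin L, MemLp (partialP i gL) 2 ((pinnedChain ω₂ lam β γ).gibbsMeasure L T)) →
      (∃ C₂ : ℝ, 0 < C₂ ∧ ∀ N M : ℕ, 2 ≤ N → 2 ≤ M → ∃ κ₂ : ℝ, 0 < κ₂ ∧ ∀ κ : ℝ, 0 < κ → κ ≤ κ₂ →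
        ∀ (g : Fin 4 → PhaseSpace (N + M) → ℝ) (gL : PhaseSpace (N + M) → ℝ),
          (∀ a : Fin 4, g a ∈ deviceResolventFields ω₂ lam β γ T N M (termSite N M a) κ) →
          gL ∈ plainForwardFields ω₂ lam β γ T (N + M) →
          plainKubo ω₂ lam β γ T (N + M) gL *
              (kuboMatrix ω₂ lam β γ T N M g 0 0 + kuboMatrix ω₂ lam β γ T N M g 3 3 +
                2 * kuboMatrix ω₂ lam β γ T N M g 0 3) ≤
            (kuboMatrix ω₂ lam β γ T N M g 0 0 * kuboMatrix ω₂ lam β γ T N M g 3 3 -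
                (kuboMatrix ω₂ lam β γ T N M g 0 3) ^ 2) * (1 + C₂ * plainKubo ω₂ lam β γ T (N + M) gL) ∧
          plainKubo ω₂ lam β γ T (N + M) gL ≤
            C₂ * (kuboMatrix ω₂ lam β γ T N M g 0 0 + kuboMatrix ω₂ lam β γ T N M g 3 3 +
              2 * kuboMatrix ω₂ lam β γ T N M g 0 3)) →
      ∃ C₂ : ℝ, 0 < C₂ ∧ ∀ (N M : ℕ) (hN : 2 ≤ N) (hM : 2 ≤ M), ∃ κ₂ : ℝ, 0 < κ₂ ∧ ∀ κ : ℝ, 0 < κ → κ ≤ κ₂ →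
        ∀ (g : Fin 4 → PhaseSpace (N + M) → ℝ) (gL : PhaseSpace (N + M) → ℝ),
          (∀ a : Fin 4, g a ∈ deviceResolventFields ω₂ lam β γ T N M (termSite N M a) κ) →
          gL ∈ plainForwardFields ω₂ lam β γ T (N + M) →
          γ ^ 2 / T ^ 2 *
                ((κ * ∫ x, (gL ∘ siteReflection (N + M)) (x.1, -x.2) * g 0 x ∂((pinnedChain ω₂ lam β γ).gibbsMeasure (N + M) T) +
                  γ * T * ((∫ x, partialP ⟨N - 1, by omega⟩ (fun y : PhaseSpace (N + M) => (gL ∘ siteReflection (N + M)) (y.1, -y.2)) x *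
                      partialP ⟨N - 1, by omega⟩ (g 0) x ∂((pinnedChain ω₂ lam β γ).gibbsMeasure (N + M) T)) +
                    ∫ x, partialP ⟨N, by omega⟩ (fun y : PhaseSpace (N + M) => (gL ∘ siteReflection (N + M)) (y.1, -y.2)) x *
                      partialP ⟨N, by omega⟩ (g 0) x ∂((pinnedChain ω₂ lam β γ).gibbsMeasure (N + M) T))) ^ 2 -
                (κ * ∫ x, gL (x.1, -x.2) * g 0 x ∂((pinnedChain ω₂ lam β γ).gibbsMeasure (N + M) T) +
                  γ * T * ((∫ x, partialP ⟨N - 1, by omega⟩ (fun y : PhaseSpace (N + M) => gL (y.1, -y.2)) x *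
                      partialP ⟨N - 1, by omega⟩ (g 0) x ∂((pinnedChain ω₂ lam β γ).gibbsMeasure (N + M) T)) +
                    ∫ x, partialP ⟨N, by omega⟩ (fun y : PhaseSpace (N + M) => gL (y.1, -y.2)) x *
                      partialP ⟨N, by omega⟩ (g 0) x ∂((pinnedChain ω₂ lam β γ).gibbsMeasure (N + M) T))) *
                (κ * ∫ x, (gL ∘ siteReflection (N + M)) (x.1, -x.2) * g 3 x ∂((pinnedChain ω₂ lam β γ).gibbsMeasure (N + M) T) +
                  γ * T * ((∫ x, partialP ⟨N - 1, by omega⟩ (fun y : PhaseSpace (N + M) => (gL ∘ siteReflection (N + M)) (y.1, -y.2)) x *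
                      partialP ⟨N - 1, by omega⟩ (g 3) x ∂((pinnedChain ω₂ lam β γ).gibbsMeasure (N + M) T)) +
                    ∫ x, partialP ⟨N, by omega⟩ (fun y : PhaseSpace (N + M) => (gL ∘ siteReflection (N + M)) (y.1, -y.2)) x *
                      partialP ⟨N, by omega⟩ (g 3) x ∂((pinnedChain ω₂ lam β γ).gibbsMeasure (N + M) T)))) *
              (1 + C₂ * plainKubo ω₂ lam β γ T (N + M) gL) ≤
            C₂ * plainKubo ω₂ lam β γ T (N + M) gL ^ 2 *
              ((κ * ∫ x, gL (x.1, -x.2) * g 0 x ∂((pinnedChain ω₂ lam β γ).gibbsMeasure (N + M) T) +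
                  γ * T * ((∫ x, partialP ⟨N - 1, by omega⟩ (fun y : PhaseSpace (N + M) => gL (y.1, -y.2)) x *
                      partialP ⟨N - 1, by omega⟩ (g 0) x ∂((pinnedChain ω₂ lam β γ).gibbsMeasure (N + M) T)) +
                    ∫ x, partialP ⟨N, by omega⟩ (fun y : PhaseSpace (N + M) => gL (y.1, -y.2)) x *
                      partialP ⟨N, by omega⟩ (g 0) x ∂((pinnedChain ω₂ lam β γ).gibbsMeasure (N + M) T))) +
                (κ * ∫ x, (gL ∘ siteReflection (N + M)) (x.1, -x.2) * g 3 x ∂((pinnedChain ω₂ lam β γ).gibbsMeasure (N + M) T) +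
                  γ * T * ((∫ x, partialP ⟨N - 1, by omega⟩ (fun y : PhaseSpace (N + M) => (gL ∘ siteReflection (N + M)) (y.1, -y.2)) x *
                      partialP ⟨N - 1, by omega⟩ (g 3) x ∂((pinnedChain ω₂ lam β γ).gibbsMeasure (N + M) T)) +
                    ∫ x, partialP ⟨N, by omega⟩ (fun y : PhaseSpace (N + M) => (gL ∘ siteReflection (N + M)) (y.1, -y.2)) x *
                      partialP ⟨N, by omega⟩ (g 3) x ∂((pinnedChain ω₂ lam β γ).gibbsMeasure (N + M) T))) +
                2 * (κ * ∫ x, (gL ∘ siteReflection (N + M)) (x.1, -x.2) * g 0 x ∂((pinnedChain ω₂ lam β γ).gibbsMeasure (N + M) T) +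
                  γ * T * ((∫ x, partialP ⟨N - 1, by omega⟩ (fun y : PhaseSpace (N + M) => (gL ∘ siteReflection (N + M)) (y.1, -y.2)) x *
                      partialP ⟨N - 1, by omega⟩ (g 0) x ∂((pinnedChain ω₂ lam β γ).gibbsMeasure (N + M) T)) +
                    ∫ x, partialP ⟨N, by omega⟩ (fun y : PhaseSpace (N + M) => (gL ∘ siteReflection (N + M)) (y.1, -y.2)) x *
                      partialP ⟨N, by omega⟩ (g 0) x ∂((pinnedChain ω₂ lam β γ).gibbsMeasure (N + M) T)))) ∧
          plainKubo ω₂ lam β γ T (N + M) gL ≤ C₂ * (γ ^ 2 / T ^ 2) *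
            ((κ * ∫ x, gL (x.1, -x.2) * g 0 x ∂((pinnedChain ω₂ lam β γ).gibbsMeasure (N + M) T) +
                  γ * T * ((∫ x, partialP ⟨N - 1, by omega⟩ (fun y : PhaseSpace (N + M) => gL (y.1, -y.2)) x *
                      partialP ⟨N - 1, by omega⟩ (g 0) x ∂((pinnedChain ω₂ lam β γ).gibbsMeasure (N + M) T)) +
                    ∫ x, partialP ⟨N, by omega⟩ (fun y : PhaseSpace (N + M) => gL (y.1, -y.2)) x *
                      partialP ⟨N, by omega⟩ (g 0) x ∂((pinnedChain ω₂ lam β γ).gibbsMeasure (N + M) T))) +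
              (κ * ∫ x, (gL ∘ siteReflection (N + M)) (x.1, -x.2) * g 3 x ∂((pinnedChain ω₂ lam β γ).gibbsMeasure (N + M) T) +
                  γ * T * ((∫ x, partialP ⟨N - 1, by omega⟩ (fun y : PhaseSpace (N + M) => (gL ∘ siteReflection (N + M)) (y.1, -y.2)) x *
                      partialP ⟨N - 1, by omega⟩ (g 3) x ∂((pinnedChain ω₂ lam β γ).gibbsMeasure (N + M) T)) +
                    ∫ x, partialP ⟨N, by omega⟩ (fun y : PhaseSpace (N + M) => (gL ∘ siteReflection (N + M)) (y.1, -y.2)) x *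
                      partialP ⟨N, by omega⟩ (g 3) x ∂((pinnedChain ω₂ lam β γ).gibbsMeasure (N + M) T))) +
              2 * (κ * ∫ x, (gL ∘ siteReflection (N + M)) (x.1, -x.2) * g 0 x ∂((pinnedChain ω₂ lam β γ).gibbsMeasure (N + M) T) +
                  γ * T * ((∫ x, partialP ⟨N - 1, by omega⟩ (fun y : PhaseSpace (N + M) => (gL ∘ siteReflection (N + M)) (y.1, -y.2)) x *
                      partialP ⟨N - 1, by omega⟩ (g 0) x ∂((pinnedChain ω₂ lam β γ).gibbsMeasure (N + M) T)) +
                    ∫ x, partialP ⟨N, by omega⟩ (fun y : PhaseSpace (N + M) => (gL ∘ siteReflection (N + M)) (y.1, -y.2)) x *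
                      partialP ⟨N, by omega⟩ (g 0) x ∂((pinnedChain ω₂ lam β γ).gibbsMeasure (N + M) T)))) := by
  intro ω₂ lam β γ T hω hl hβ hγ hT hR hS
  obtain ⟨C₂, hC₂, hS⟩ := hS
  refine ⟨C₂, hC₂, fun N M hN hM => ?_⟩
  obtain ⟨κ₂, hκ₂, hS⟩ := hS N M hN hM
  refine ⟨κ₂, hκ₂, fun κ hκ hκle g gL hg hgL => ?_⟩
  obtain ⟨hS1, hS2⟩ := hS κ hκ hκle g gL hg hgL
  obtain ⟨h1, h2, h3, -, -⟩ :=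
    schurVariables_eq_junctionPairing hω hl hβ hγ hT hN hM hκ.le g gL hg hgL (hR (N + M) gL hgL)
  have hc : 0 < γ ^ 2 / T ^ 2 := by positivity
  exact (probeRemoval_algebra hc h1 h2 h3).mp ⟨hS1, hS2⟩

/-- **The connectivity margin in junction-pairing form (pointwise).** For a resolvent family and a plain forward field with
square-integrable momentum gradients, `a + b − 2x = K₀₀ + K₃₃ + 2K₀₃ = (γ²/T²)(Π_L0 + Π_R3 + 2Π_R0)`, so the second clause of
S3' `G_L ≤ C₂(a + b − 2x)` is the inequality (J2) verbatim. -/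
theorem connectivityMargin_iff_junctionPairing (hω : 0 < ω₂) (hl : 0 < lam) (hβ : 0 < β) (hγ : 0 < γ) (hT : 0 < T)
    (hN : 2 ≤ N) (hM : 2 ≤ M) {κ : ℝ} (hκ : 0 ≤ κ) (g : Fin 4 → PhaseSpace (N + M) → ℝ) (gL : PhaseSpace (N + M) → ℝ)
    (hg : ∀ a : Fin 4, g a ∈ deviceResolventFields ω₂ lam β γ T N M (termSite N M a) κ)
    (hgL : gL ∈ plainForwardFields ω₂ lam β γ T (N + M))
    (hreg : ∀ i : Fin (N + M), MemLp (partialP i gL) 2 ((pinnedChain ω₂ lam β γ).gibbsMeasure (N + M) T)) (C₂ : ℝ) :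
    plainKubo ω₂ lam β γ T (N + M) gL ≤ C₂ * (kuboMatrix ω₂ lam β γ T N M g 0 0 + kuboMatrix ω₂ lam β γ T N M g 3 3 +
        2 * kuboMatrix ω₂ lam β γ T N M g 0 3) ↔
      plainKubo ω₂ lam β γ T (N + M) gL ≤ C₂ * (γ ^ 2 / T ^ 2) *
        ((κ * ∫ x, gL (x.1, -x.2) * g 0 x ∂((pinnedChain ω₂ lam β γ).gibbsMeasure (N + M) T) +
          γ * T * ((∫ x, partialP ⟨N - 1, by omega⟩ (fun y : PhaseSpace (N + M) => gL (y.1, -y.2)) x *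
              partialP ⟨N - 1, by omega⟩ (g 0) x ∂((pinnedChain ω₂ lam β γ).gibbsMeasure (N + M) T)) +
            ∫ x, partialP ⟨N, by omega⟩ (fun y : PhaseSpace (N + M) => gL (y.1, -y.2)) x *
              partialP ⟨N, by omega⟩ (g 0) x ∂((pinnedChain ω₂ lam β γ).gibbsMeasure (N + M) T))) +
          (κ * ∫ x, (gL ∘ siteReflection (N + M)) (x.1, -x.2) * g 3 x ∂((pinnedChain ω₂ lam β γ).gibbsMeasure (N + M) T) +
            γ * T * ((∫ x, partialP ⟨N - 1, by omega⟩ (fun y : PhaseSpace (N + M) => (gL ∘ siteReflection (N + M)) (y.1, -y.2)) x *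
                partialP ⟨N - 1, by omega⟩ (g 3) x ∂((pinnedChain ω₂ lam β γ).gibbsMeasure (N + M) T)) +
              ∫ x, partialP ⟨N, by omega⟩ (fun y : PhaseSpace (N + M) => (gL ∘ siteReflection (N + M)) (y.1, -y.2)) x *
                partialP ⟨N, by omega⟩ (g 3) x ∂((pinnedChain ω₂ lam β γ).gibbsMeasure (N + M) T))) +
          2 * (κ * ∫ x, (gL ∘ siteReflection (N + M)) (x.1, -x.2) * g 0 x ∂((pinnedChain ω₂ lam β γ).gibbsMeasure (N + M) T) +
            γ * T * ((∫ x, partialP ⟨N - 1, by omega⟩ (fun y : PhaseSpace (N + M) => (gL ∘ siteReflection (N + M)) (y.1, -y.2)) x *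
                partialP ⟨N - 1, by omega⟩ (g 0) x ∂((pinnedChain ω₂ lam β γ).gibbsMeasure (N + M) T)) +
              ∫ x, partialP ⟨N, by omega⟩ (fun y : PhaseSpace (N + M) => (gL ∘ siteReflection (N + M)) (y.1, -y.2)) x *
                partialP ⟨N, by omega⟩ (g 0) x ∂((pinnedChain ω₂ lam β γ).gibbsMeasure (N + M) T)))) := by
  obtain ⟨h1, h2, h3, -, -⟩ := schurVariables_eq_junctionPairing hω hl hβ hγ hT hN hM hκ g gL hg hgL hreg
  have hsum : kuboMatrix ω₂ lam β γ T N M g 0 0 + kuboMatrix ω₂ lam β γ T N M g 3 3 +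
      2 * kuboMatrix ω₂ lam β γ T N M g 0 3 = γ ^ 2 / T ^ 2 *
        ((κ * ∫ x, gL (x.1, -x.2) * g 0 x ∂((pinnedChain ω₂ lam β γ).gibbsMeasure (N + M) T) +
          γ * T * ((∫ x, partialP ⟨N - 1, by omega⟩ (fun y : PhaseSpace (N + M) => gL (y.1, -y.2)) x *
              partialP ⟨N - 1, by omega⟩ (g 0) x ∂((pinnedChain ω₂ lam β γ).gibbsMeasure (N + M) T)) +
            ∫ x, partialP ⟨N, by omega⟩ (fun y : PhaseSpace (N + M) => gL (y.1, -y.2)) x *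
              partialP ⟨N, by omega⟩ (g 0) x ∂((pinnedChain ω₂ lam β γ).gibbsMeasure (N + M) T))) +
          (κ * ∫ x, (gL ∘ siteReflection (N + M)) (x.1, -x.2) * g 3 x ∂((pinnedChain ω₂ lam β γ).gibbsMeasure (N + M) T) +
            γ * T * ((∫ x, partialP ⟨N - 1, by omega⟩ (fun y : PhaseSpace (N + M) => (gL ∘ siteReflection (N + M)) (y.1, -y.2)) x *
                partialP ⟨N - 1, by omega⟩ (g 3) x ∂((pinnedChain ω₂ lam β γ).gibbsMeasure (N + M) T)) +
              ∫ x, partialP ⟨N, by omega⟩ (fun y : PhaseSpace (N + M) => (gL ∘ siteReflection (N + M)) (y.1, -y.2)) x *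
                partialP ⟨N, by omega⟩ (g 3) x ∂((pinnedChain ω₂ lam β γ).gibbsMeasure (N + M) T))) +
          2 * (κ * ∫ x, (gL ∘ siteReflection (N + M)) (x.1, -x.2) * g 0 x ∂((pinnedChain ω₂ lam β γ).gibbsMeasure (N + M) T) +
            γ * T * ((∫ x, partialP ⟨N - 1, by omega⟩ (fun y : PhaseSpace (N + M) => (gL ∘ siteReflection (N + M)) (y.1, -y.2)) x *
                partialP ⟨N - 1, by omega⟩ (g 0) x ∂((pinnedChain ω₂ lam β γ).gibbsMeasure (N + M) T)) +
              ∫ x, partialP ⟨N, by omega⟩ (fun y : PhaseSpace (N + M) => (gL ∘ siteReflection (N + M)) (y.1, -y.2)) x *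
                partialP ⟨N, by omega⟩ (g 0) x ∂((pinnedChain ω₂ lam β γ).gibbsMeasure (N + M) T)))) := by
    linear_combination h1 + h2 + 2 * h3
  rw [hsum]
  constructor <;> intro h <;> linarith

/-- Registered helper sub-goal `helper_probeRemovalConnectivityReduction` (= `connectivityMargin_iff_junctionPairing` on one line,
all binders explicit): the connectivity clause of S3' in junction-pairing form. -/
theorem helper_probeRemovalConnectivityReduction : ∀ (ω₂ lam β γ T : ℝ) (N M : ℕ), 0 < ω₂ → 0 < lam → 0 < β → 0 < γ → 0 < T → ∀ (hN : 2 ≤ N) (hM : 2 ≤ M) (κ : ℝ), 0 ≤ κ → ∀ (g : Fin 4 → PhaseSpace (N + M) → ℝ) (gL : PhaseSpace (N + M) → ℝ), (∀ a : Fin 4, g a ∈ deviceResolventFields ω₂ lam β γ T N M (termSite N M a) κ) → gL ∈ plainForwardFields ω₂ lam β γ T (N + M) → (∀ i : Fin (N + M), MemLp (partialP i gL) 2 ((pinnedChain ω₂ lam β γ).gibbsMeasure (N + M) T)) → ∀ (C₂ : ℝ), (plainKubo ω₂ lam β γ T (N + M) gL ≤ C₂ * (kuboMatrix ω₂ lam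 β γ T N M g 0 0 + kuboMatrix ω₂ lam β γ T N M g 3 3 + 2 * kuboMatrix ω₂ lam β γ T N M g 0 3) ↔ plainKubo ω₂ lam β γ T (N + M) gL ≤ C₂ * (γ ^ 2 / T ^ 2) * ((κ * ∫ x, gL (x.1, -x.2) * g 0 x ∂((pinnedChain ω₂ lam β γ).gibbsMeasure (N + M) T) + γ * T * ((∫ x, partialP ⟨N - 1, by omega⟩ (fun y : PhaseSpace (N + M) => gL (y.1, -y.2)) x * partialP ⟨N - 1, by omega⟩ (g 0) x ∂((pinnedChain ω₂ lam β γ).gibbsMeasure (N + M) T)) + ∫ x, partialP ⟨N, by omega⟩ (fun y : PhaseSpace (N + M) => gL (y.1, -y.2)) x * partialP ⟨N, by omega⟩ (g 0) x ∂((pinnedChain ω₂ lam β γ).gibbsMeasure (N + M) T))) + (κ * ∫ x, (gL ∘ siteReflection (N + M)) (x.1, -x.2) * g 3 x ∂((pinnedChain ω₂ lam β γ).gibbsMeasure (N + M) T) + γ * T * ((∫ x, partialP ⟨N - 1, by omega⟩ (fun y : PhaseSpace (N + M) => (gL ∘ siteReflection (N + M)) (y.1, -y.2)) x * partialP ⟨N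 - 1, by omega⟩ (g 3) x ∂((pinnedChain ω₂ lam β γ).gibbsMeasure (N + M) T)) + ∫ x, partialP ⟨N, by omega⟩ (fun y : PhaseSpace (N + M) => (gL ∘ siteReflection (N + M)) (y.1, -y.2)) x * partialP ⟨N, by omega⟩ (g 3) x ∂((pinnedChain ω₂ lam β γ).gibbsMeasure (N + M) T))) + 2 * (κ * ∫ x, (gL ∘ siteReflection (N + M)) (x.1, -x.2) * g 0 x ∂((pinnedChain ω₂ lam β γ).gibbsMeasure (N + M) T) + γ * T * ((∫ x, partialP ⟨N - 1, by omega⟩ (fun y : PhaseSpace (N + M) => (gL ∘ siteReflection (N + M)) (y.1, -y.2)) x * partialP ⟨N - 1, by omega⟩ (g 0) x ∂((pinnedChain ω₂ lam β γ).gibbsMeasure (N + M) T)) + ∫ x, partialP ⟨N, by omega⟩ (fun y : PhaseSpace (N + M) => (gL ∘ siteReflection (N + M)) (y.1, -y.2)) x * partialP ⟨N, by omega⟩ (g 0) x ∂((pinnedChain ω₂ lam β γ).gibbsMeasure (N + M) T))))) :=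
  fun _ _ _ _ _ _ _ hω hl hβ hγ hT hN hM _ hκ g gL hg hgL hreg C₂ =>
    connectivityMargin_iff_junctionPairing hω hl hβ hγ hT hN hM hκ g gL hg hgL hreg C₂

end Reduction

end Summit.AtomisticToContinuum.FouriersLaw.Cruxes.SuperadditiveResistance.FloatingProbeBypassLaplacian

end
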